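import Summits.QuantumFields.YangMills.Theses.LangevinControlUV
import Summits.QuantumFields.YangMills.Theorems.LangevinControlUVOSLegsFromFemtoAndGapStubPinAux

/-!
# Crux `LatticeGapInUVUnitsC` (stmt-QuantumFields-16206), line `Sketch` (amplitude-exhaustion-ratchet, v2): stub `stub_ratioSeed`

Registered stub S1 (the SEED of the ratio version) of the skeleton `work/LatticeGapInUVUnitsC.lean` of route
`LangevinControlUV` of `YangMills`.  The line proves the crux by exhaustion of the dimensionless axis-covariance RATIO

  `v(β, k) := Cov_{β,(ℤ/16k)⁴}(P_0^{01}, P_{2k e₂}^{01}) / Cov_{β,(ℤ/16k)⁴}(P_0^{01}, P_{k e₂}^{01})`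

(the femto two-point package's axis observable at the two largest separations it pins, `2k = L/8` and `k = L/16`, read
on the torus of side `L = 16k`) along a dyadic ladder starting at the femto edge.  This file is the seed:
`v ≥ vmin > 0` on the top femto octave `ℓ₀/32 ≤ k a(β) ≤ ℓ₀/16`, for every `β ≥ β₀` — the one place where the LOWER
bound `c Γ ≤ n⁸ Cov` of the package does infrared work.  It is bookkeeping over the landed interval pinning for
continuous unit maps (`OSLegsFromFemtoAndGap.pinning_of_femtoBox`: `Γ ≥ m > 0` on `[ℓ₀/16, ℓ₀/8]`) and the package's
axis clause on the femto torus `L = 16k`: the lower clause at separation `n = 2k` gives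
`(2k)⁸ Cov(2k) ≥ c Γ(2k a β) ≥ c m`, the two clauses at `n = k` give `0 < k⁸ Cov(k) ≤ C Γ(k a β) ≤ max C c`
(`Γ ≤ 1` on `(0, ℓ₀]`), whence `v ≥ c m / (2⁸ max C c) =: vmin`.
-/

set_option autoImplicit false

open MeasureTheory Filter Topology
open Literature.MathematicalPhysics.QuantumFieldTheory Literature.MathematicalPhysics.QuantumLattice

noncomputable section

namespace Summit.QuantumFields.YangMills.Theorems.LatticeGapInUVUnitsC.AmplitudeRatchet

/-- **Stub S1 (v2) — RATIO SEED** (bookkeeping; the one place the package's LOWER bound does infrared work).  For a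
CONTINUOUS unit map `a` carrying the femto two-point package (positivity and vanishing of `a`, shape `0 < Γ ≤ 1` on
`(0, ℓ₀]`, constants `β₀`, `ℓ₀ > 0`, `c > 0`, `C`, and the verbatim femto-box clause on all tori `L a(β) ≤ ℓ₀`,
`β ≥ β₀`), the ratio `Cov_{β,(ℤ/16k)⁴}(P_0^{01}, P_{2k e₂}^{01}) / Cov_{β,(ℤ/16k)⁴}(P_0^{01}, P_{k e₂}^{01})` of the axis
plaquette covariances on the top femto octave `ℓ₀/32 ≤ k a(β) ≤ ℓ₀/16` is bounded below by
`vmin = c · m / (2⁸ · max C c) > 0`, `m = min_{[ℓ₀/16, ℓ₀/8]} Γ` (`pinning_of_femtoBox`), for all `β ≥ β₀`: the octave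
forces `k ≥ 1` and `16k · a(β) ≤ ℓ₀`, so the package's axis clause on the torus `L = 16k` applies at `n = 2k` (lower
bound, `Γ(2k a β) ≥ m`) and at `n = k` (both bounds: the denominator is positive and `≤ C Γ(k a β)/k⁸ ≤ max C c / k⁸`
as `Γ ≤ 1`). -/
theorem stub_ratioSeed : ∀ (G : Type) [Group G] [TopologicalSpace G] [IsTopologicalGroup G] [CompactSpace G] [MeasurableSpace G] [BorelSpace G] (r : LatticeRep G) (a Γ : ℝ → ℝ) (β₀ ℓ₀ c C : ℝ), Continuous a → 0 < ℓ₀ → 0 < c → (∀ β, 0 < a β) → Filter.Tendsto a Filter.atTop (nhds 0) → (∀ s : ℝ, 0 < s → s ≤ ℓ₀ → 0 < Γ s ∧ Γ s ≤ 1) → (∀ (L : ℕ) [NeZero L] (β : ℝ), β₀ ≤ β → (L : ℝ) * a β ≤ ℓ₀ → let P : (Fin 4 → ZMod L) → Fin 4 → Fin 4 → GaugeConfig 4 L G → ℝ := fun x i j U => (r.N : ℝ) - (r.ρ (plaquetteHolonomy U x i j)).trace.re; let E : (GaugeConfig 4 L G → ℝ) → ℝ := fun F => wilsonExpectation (d :=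 4) (L := L) r.ρ β F; let cov : (GaugeConfig 4 L G → ℝ) → (GaugeConfig 4 L G → ℝ) → ℝ := fun F F' => E (fun U => F U * F' U) - E F * E F'; let dist : (Fin 4 → ZMod L) → (Fin 4 → ZMod L) → ℝ := fun x y => Real.sqrt (∑ k : Fin 4, (((x k - y k).valMinAbs : ℤ) : ℝ) ^ 2); (∀ n : ℕ, 1 ≤ n → 8 * n ≤ L → c * Γ ((n : ℝ) * a β) ≤ (n : ℝ) ^ 8 * cov (P 0 0 1) (P (Pi.single (2 : Fin 4) ((n : ℕ) : ZMod L)) 0 1) ∧ (n : ℝ) ^ 8 * cov (P 0 0 1) (P (Pi.single (2 : Fin 4) ((n : ℕ) : ZMod L)) 0 1) ≤ C * Γ ((n : ℝ) * a β)) ∧ (∀ (x y : Fin 4 → ZMod L) (i j i' j' : Fin 4), x ≠ y → i ≠ j → i' ≠ j' → |cov (P x i j) (P y i' j')| * dist x y ^ 8 ≤ C * Γ (dist x y * a β))) → ∃ vmin : ℝ, 0 < vmin ∧ ∀ β : ℝ, β₀ ≤ β → ∀ (k : ℕ) [NeZero (16 * k)], ℓ₀ ≤ 32 * ((k : ℝ)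 * a β) → 16 * ((k : ℝ) * a β) ≤ ℓ₀ → vmin ≤ (wilsonExpectation r.ρ β (fun U : GaugeConfig 4 (16 * k) G => ((r.N : ℝ) - (r.ρ (plaquetteHolonomy U 0 0 1)).trace.re) * ((r.N : ℝ) - (r.ρ (plaquetteHolonomy U (Pi.single (2 : Fin 4) (((2 * k) : ℕ) : ZMod (16 * k))) 0 1)).trace.re)) - wilsonExpectation r.ρ β (fun U : GaugeConfig 4 (16 * k) G => (r.N : ℝ) - (r.ρ (plaquetteHolonomy U 0 0 1)).trace.re) * wilsonExpectation r.ρ β (fun U : GaugeConfig 4 (16 * k) G => (r.N : ℝ) - (r.ρ (plaquetteHolonomy U (Pi.single (2 : Fin 4) (((2 * k) : ℕ) : ZMod (16 * k))) 0 1)).trace.re)) / (wilsonExpectation r.ρ β (fun U : GaugeConfig 4 (16 * k) G => ((r.N : ℝ) - (r.ρ (plaquetteHolonomy U 0 0 1)).trace.re) * ((r.N : ℝ) - (r.ρ (plaquetteHolonomy U (Pi.single (2 : Fin 4) ((k : ℕ) : ZMod (16 * k))) 0 1)).trace.re)) - wilsonExpectation r.ρ β (fun U : GaugeConfig 4 (16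 * k) G => (r.N : ℝ) - (r.ρ (plaquetteHolonomy U 0 0 1)).trace.re) * wilsonExpectation r.ρ β (fun U : GaugeConfig 4 (16 * k) G => (r.N : ℝ) - (r.ρ (plaquetteHolonomy U (Pi.single (2 : Fin 4) ((k : ℕ) : ZMod (16 * k))) 0 1)).trace.re)) := by
  intro G _ _ _ _ _ _ r a Γ β₀ ℓ₀ c C ha hℓ₀ hc hpos hlim hΓ hbox
  -- interval pinning of the shape function on `[ℓ₀/16, ℓ₀/8]` (twice the top femto octave of `k a β`)
  obtain ⟨m, hm, hmΓ⟩ :=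
    Summit.QuantumFields.YangMills.Theorems.OSLegsFromFemtoAndGap.pinning_of_femtoBox r ha hc hpos hlim hΓ hbox
      (ℓ₀ / 16) (ℓ₀ / 8) (by positivity) (by linarith) (by linarith)
  have hM : 0 < max C c := lt_max_of_lt_right hc
  refine ⟨c * m / (2 ^ 8 * max C c), by positivity, fun β hβ k _ h32 h16 => ?_⟩
  -- the octave forces `k ≥ 1`
  have hk : 1 ≤ k := by
    rcases Nat.eq_zero_or_pos k with h | h
    · exfalso
      rw [h, Nat.cast_zero, zero_mul, mul_zero] at h32
      linarith
    · exact h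
  have hk0 : (0 : ℝ) < (k : ℝ) := by exact_mod_cast hk
  have hka : 0 < (k : ℝ) * a β := mul_pos hk0 (hpos β)
  have hK : (0 : ℝ) < (k : ℝ) ^ 8 := pow_pos hk0 8
  -- the torus `L = 16k` is a femto torus
  have hL : ((16 * k : ℕ) : ℝ) * a β ≤ ℓ₀ := by push_cast; linarith
  obtain ⟨hax, -⟩ := hbox (16 * k) β hβ hL
  -- shape-function inputs: `Γ(2k a β) ≥ m` (`2k a β ∈ [ℓ₀/16, ℓ₀/8]`), `0 < Γ(k a β) ≤ 1` (`0 < k a β ≤ ℓ₀`)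
  have e2k : ((2 * k : ℕ) : ℝ) * a β = 2 * ((k : ℝ) * a β) := by push_cast; ring
  have hm2 : m ≤ Γ (((2 * k : ℕ) : ℝ) * a β) := by
    rw [e2k]
    exact hmΓ _ (by linarith) (by linarith)
  have hΓ1 := hΓ ((k : ℝ) * a β) hka (by linarith)
  have h2k8 : ((2 * k : ℕ) : ℝ) ^ 8 = 2 ^ 8 * (k : ℝ) ^ 8 := by push_cast; ring
  -- the real-number bookkeeping: lower clause at `n = 2k`, both clauses at `n = k`
  have key : ∀ {x y g₂ g₁ : ℝ}, c * g₂ ≤ ((2 * k : ℕ) : ℝ) ^ 8 * x → c * g₁ ≤ (k : ℝ) ^ 8 * y →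
      (k : ℝ) ^ 8 * y ≤ C * g₁ → m ≤ g₂ → 0 < g₁ → g₁ ≤ 1 → c * m / (2 ^ 8 * max C c) ≤ x / y := by
    intro x y g₂ g₁ h1 h2 h3 h4 h5 h6
    have hy : 0 < y := by
      have hKy : (k : ℝ) ^ 8 * 0 < (k : ℝ) ^ 8 * y := by
        rw [mul_zero]
        exact lt_of_lt_of_le (mul_pos hc h5) h2
      exact lt_of_mul_lt_mul_left hKy hK.le
    rw [div_le_div_iff₀ (by positivity) hy]
    refine le_of_mul_le_mul_left ?_ hK
    calc (k : ℝ) ^ 8 * (c * m * y) = c * m * ((k : ℝ) ^ 8 * y) := by ring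
      _ ≤ c * m * (C * g₁) := mul_le_mul_of_nonneg_left h3 (by positivity)
      _ ≤ c * m * (max C c * g₁) :=
          mul_le_mul_of_nonneg_left (mul_le_mul_of_nonneg_right (le_max_left C c) h5.le) (by positivity)
      _ ≤ c * m * (max C c * 1) :=
          mul_le_mul_of_nonneg_left (mul_le_mul_of_nonneg_left h6 hM.le) (by positivity)
      _ = c * m * max C c := by ring
      _ ≤ c * g₂ * max C c :=
          mul_le_mul_of_nonneg_right (mul_le_mul_of_nonneg_left h4 hc.le) hM.le
      _ ≤ ((2 * k : ℕ) : ℝ) ^ 8 * x * max C c := mul_le_mul_of_nonneg_right h1 hM.le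
      _ = (k : ℝ) ^ 8 * (x * (2 ^ 8 * max C c)) := by rw [h2k8]; ring
  exact key (hax (2 * k) (by omega) (by omega)).1 (hax k hk (by omega)).1 (hax k hk (by omega)).2 hm2 hΓ1.1 hΓ1.2

end Summit.QuantumFields.YangMills.Theorems.LatticeGapInUVUnitsC.AmplitudeRatchet

end
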